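import Literature.AlgebraicGeometry.Deformation.SmoothSchemeLiftObstructionCriterionGlueCocycle
import Literature.AlgebraicGeometry.Morphisms.GlueDataOfOpens
import HarnessLib

/-!
# Gluing the lifted charts, IV: the glue datum of cocycle-exact lifted gluing data and the glued deformation
# (Hartshorne, *Deformation Theory*, proof of Thm. 10.2 (a): «we can glue the schemes `U'_i` … to obtain `X'`»)

HOME SEED (cell `hodgecm-mathlib`, F-11 (A3) F3b FILE 2; provisional path
`Deformation/SmoothSchemeLiftObstructionCriterionGlueDatum.lean`).  DEFINITIONS (the one DEF-kind file of the F3b chain)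
+ their unfolding lemmas; imports FILE 1c and ★ `Morphisms/GlueDataOfOpens`.

INPUT = the currency of the F2/F3a files («lifted gluing data on the closed fibre», now with a general commutative
`k`-algebra `R` of coefficients): the closed fibre `X/Spec k` with a principal affine cover `U j`, `U j ∩ U l = D(b j l)`,
a nilpotent ideal `𝔫 ⊆ R`, transition automorphisms `ψ j l` of `R ⊗_k Γ(U j ∩ U l)`, `≡ 1 (mod 𝔫)`, that are
COCYCLE-EXACT in the ∀-form of F3a's `exists_cocycle_lifts_of_eq_cechMD1` (`hcoc`).  OUTPUT:

* `chartProj U j : Spec (R ⊗_k Γ(U j)) → X`, `chartOverlap U j l = chartProj⁻¹(U j ∩ U l)`, the chart ring maps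
  `overlapRingHom` and base changes `baseChangeRight` (choices of the characterised maps of FILE 1a / F2, with their
  characterising equations as lemmas), the transition maps `transitionMap`;
* **`deformationGlueDatum … hcoc : OpensGlueDatum`** — charts `Spec (R ⊗_k Γ(U j))`, opens `chartOverlap`, transitions
  `transitionMap`; the axioms `W_self`, `t_self`, `t_mem`, `dom`, `cocycle` are FILE 1b/1c's `chart_preimage_self`,
  `transition_self` + `apply_eq_self_of_cocycle_self`, `chart_transition_apply`, `transition_cocycle`;
* hence (★ `OpensGlueDatum.glueData`, Mathlib `Scheme.GlueData.glued`) THE GLUED SCHEME `X' := (deformationGlueDatum …).glueData.glued`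
  with its open cover by the `Spec (R ⊗_k Γ(U j))`; the structure morphism to `Spec R` and its properties are FILE 3.

HC_CM is proved only modulo the 7 printed citations until rung 0 closes — nothing here bears on a summit statement.

## References
* [Hartshorne2010] R. Hartshorne, *Deformation Theory*, GTM 257, Springer (2010): Thm. 10.2 (a) and its proof (p. 81).
* [StacksProject] The Stacks Project, Tag 01JA (glueing schemes).
* [Hartshorne1977] R. Hartshorne, *Algebraic Geometry*, GTM 52 (1977): II Ex. 2.12 (glueing).
-/

noncomputable section

-- `TopCat.Presheaf`/`TopCat.Sheaf` are not reducible (as in Mathlib's `AlgebraicGeometry/Modules`).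
set_option backward.isDefEq.respectTransparency false

open CategoryTheory AlgebraicGeometry Opposite TopologicalSpace
open scoped TensorProduct

universe u

namespace Literature.AlgebraicGeometry.Deformation

open Literature.AlgebraicGeometry.Motives Literature.AlgebraicGeometry.Morphisms

variable {k : Type u} [Field k] {X : Over (Spec (CommRingCat.of k))}
  [instΓ : ∀ W : X.left.Opens, Algebra k Γ(X.left, W)]
  (halg : ∀ (W : X.left.Opens) (s : k), algebraMap k Γ(X.left, W) s = (constToPresheaf X).app (op W) s)
  (R : Type u) [CommRing R] [Algebra k R]
  {ι : Type u} (U : ι → X.left.affineOpens) (b : (j l : ι) → Γ(X.left, (U j).1))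
  (hb : ∀ j l, (U j).1 ⊓ (U l).1 = X.left.basicOpen (b j l))

/-! ## §1 Charts, overlaps, chart ring maps, base changes -/

/-- The chart projection `Spec (R ⊗_k Γ(U j)) → X` (`= Spec (c ↦ 1 ⊗ c) ≫ (U j ↪ X)`). [cite: Hartshorne2010, Thm. 10.2 (proof), p. 81] -/
def chartProj (j : ι) : Spec (CommRingCat.of (R ⊗[k] Γ(X.left, (U j).1))) ⟶ X.left :=
  Spec.map (CommRingCat.ofHom
    (Algebra.TensorProduct.includeRight (R := k) (A := R) (B := Γ(X.left, (U j).1))).toRingHom) ≫ (U j).2.fromSpec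

/-- Unfolding of `chartProj`. [cite: Hartshorne2010, Thm. 10.2 (proof), p. 81] -/
theorem chartProj_eq (j : ι) : chartProj R U j = Spec.map (CommRingCat.ofHom
    (Algebra.TensorProduct.includeRight (R := k) (A := R) (B := Γ(X.left, (U j).1))).toRingHom) ≫ (U j).2.fromSpec :=
  rfl

/-- The overlap `W j l := chartProj⁻¹(U j ∩ U l) ⊆ Spec (R ⊗_k Γ(U j))`. [cite: StacksProject, Tag 01JA] -/
def chartOverlap (j l : ι) : (Spec (CommRingCat.of (R ⊗[k] Γ(X.left, (U j).1)))).Opens :=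
  chartProj R U j ⁻¹ᵁ ((U j).1 ⊓ (U l).1)

/-- Unfolding of `chartOverlap`. [cite: StacksProject, Tag 01JA] -/
theorem chartOverlap_eq (j l : ι) : chartOverlap R U j l = chartProj R U j ⁻¹ᵁ ((U j).1 ⊓ (U l).1) := rfl

/-- The overlap lies over `U j ∩ U l`. [cite: StacksProject, Tag 01JA] -/
theorem chartOverlap_le (j l : ι) :
    ⊤ ≤ ((chartOverlap R U j l).ι ≫ chartProj R U j) ⁻¹ᵁ ((U j).1 ⊓ (U l).1) := fun x _ => x.2

include halg in
/-- **The chart ring map of the overlap** `Λ_{jl} : R ⊗_k Γ(U j ∩ U l) → Γ(W j l)` (a choice of the characterised map of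
FILE 1a `exists_chartRingHom`). [cite: Hartshorne2010, Thm. 10.2 (proof), p. 81] -/
def overlapRingHom (j l : ι) : R ⊗[k] Γ(X.left, (U j).1 ⊓ (U l).1) →+* Γ(↑(chartOverlap R U j l), ⊤) :=
  (exists_chartRingHom halg (U j).2 (chartProj R U j) rfl (chartOverlap R U j l)
    (inf_le_left : (U j).1 ⊓ (U l).1 ≤ (U j).1) (chartOverlap_le R U j l)).choose

include halg in
/-- `Λ_{jl} (r ⊗ 1) = r|_{W j l}`. [cite: Hartshorne2010, Thm. 10.2 (proof), p. 81] -/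
theorem overlapRingHom_tmul_one (j l : ι) (r : R) : overlapRingHom halg R U j l (r ⊗ₜ 1) =
    (chartOverlap R U j l).ι.appTop
      ((Scheme.ΓSpecIso (CommRingCat.of (R ⊗[k] Γ(X.left, (U j).1)))).inv (r ⊗ₜ 1)) :=
  (exists_chartRingHom halg (U j).2 (chartProj R U j) rfl (chartOverlap R U j l)
    (inf_le_left : (U j).1 ⊓ (U l).1 ≤ (U j).1) (chartOverlap_le R U j l)).choose_spec.1 r

include halg in
/-- `Λ_{jl} (1 ⊗ c) = (chartProj^* c)|_{W j l}`. [cite: Hartshorne2010, Thm. 10.2 (proof), p. 81] -/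
theorem overlapRingHom_one_tmul (j l : ι) (c : Γ(X.left, (U j).1 ⊓ (U l).1)) : overlapRingHom halg R U j l (1 ⊗ₜ c) =
    ((chartOverlap R U j l).ι ≫ chartProj R U j).appLE ((U j).1 ⊓ (U l).1) ⊤ (chartOverlap_le R U j l) c :=
  (exists_chartRingHom halg (U j).2 (chartProj R U j) rfl (chartOverlap R U j l)
    (inf_le_left : (U j).1 ⊓ (U l).1 ≤ (U j).1) (chartOverlap_le R U j l)).choose_spec.2 c

include halg in
/-- **The base change `R ⊗_k Γ(U l) → R ⊗_k Γ(U j ∩ U l)`**, `a ⊗ s ↦ a ⊗ s|` (a choice of F2's characterised map).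
[cite: Hartshorne2010, Thm. 10.2 (proof), p. 81 (restricting to `U_{ij}`)] -/
def baseChangeRight (j l : ι) : R ⊗[k] Γ(X.left, (U l).1) →ₐ[R] R ⊗[k] Γ(X.left, (U j).1 ⊓ (U l).1) :=
  (exists_baseChangeMap (A' := R) halg (U l).1 ((U j).1 ⊓ (U l).1) inf_le_right).choose

include halg in
/-- `Φ (a ⊗ s) = a ⊗ s|_{U j ∩ U l}`. [cite: Hartshorne2010, Thm. 10.2 (proof), p. 81] -/
theorem baseChangeRight_tmul (j l : ι) (a : R) (s : Γ(X.left, (U l).1)) : baseChangeRight halg R U j l (a ⊗ₜ s) =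
    a ⊗ₜ X.left.presheaf.map (homOfLE inf_le_right).op s :=
  (exists_baseChangeMap (A' := R) halg (U l).1 ((U j).1 ⊓ (U l).1) inf_le_right).choose_spec a s

variable (ψ : (j l : ι) → R ⊗[k] Γ(X.left, (U j).1 ⊓ (U l).1) ≃ₐ[R] R ⊗[k] Γ(X.left, (U j).1 ⊓ (U l).1))

include halg in
/-- **The transition map** `t j l = W j l .toSpecΓ ≫ Spec (Λ_{jl} ∘ ψ_{jl}⁻¹ ∘ Φ) : W j l → Spec (R ⊗_k Γ(U l))`.
[cite: Hartshorne2010, Thm. 10.2 (proof), p. 81] [cite: StacksProject, Tag 01JA] -/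
def transitionMap (j l : ι) :
    ((chartOverlap R U j l : (Spec (CommRingCat.of (R ⊗[k] Γ(X.left, (U j).1)))).Opens) : Scheme.{u}) ⟶
      Spec (CommRingCat.of (R ⊗[k] Γ(X.left, (U l).1))) :=
  (chartOverlap R U j l : Scheme.{u}).toSpecΓ ≫ Spec.map (CommRingCat.ofHom
    ((overlapRingHom halg R U j l).comp ((ψ j l).symm.toAlgHom.toRingHom.comp (baseChangeRight halg R U j l).toRingHom)))

include halg in
/-- Unfolding of `transitionMap`. [cite: StacksProject, Tag 01JA] -/
theorem transitionMap_eq (j l : ι) : transitionMap halg R U ψ j l =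
    (chartOverlap R U j l : Scheme.{u}).toSpecΓ ≫ Spec.map (CommRingCat.ofHom
      ((overlapRingHom halg R U j l).comp
        ((ψ j l).symm.toAlgHom.toRingHom.comp (baseChangeRight halg R U j l).toRingHom))) := rfl

/-! ## §2 The glue datum -/

variable (𝔫 : Ideal R) (h𝔫 : IsNilpotent 𝔫)
  (hψ : ∀ j l x, ψ j l x - x ∈ 𝔫 • (⊤ : Submodule R (R ⊗[k] Γ(X.left, (U j).1 ⊓ (U l).1))))
  (hcoc : ∀ (j l m : ι)
    (Φjl : R ⊗[k] Γ(X.left, (U j).1 ⊓ (U l).1) →ₐ[R] R ⊗[k] Γ(X.left, (U j).1 ⊓ (U l).1 ⊓ (U m).1))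
    (_ : ∀ a s, Φjl (a ⊗ₜ s) = a ⊗ₜ X.left.presheaf.map (homOfLE inf_le_left).op s)
    (Φlm : R ⊗[k] Γ(X.left, (U l).1 ⊓ (U m).1) →ₐ[R] R ⊗[k] Γ(X.left, (U j).1 ⊓ (U l).1 ⊓ (U m).1))
    (_ : ∀ a s, Φlm (a ⊗ₜ s) = a ⊗ₜ X.left.presheaf.map
      (homOfLE (le_inf (inf_le_left.trans inf_le_right) inf_le_right)).op s)
    (Φjm : R ⊗[k] Γ(X.left, (U j).1 ⊓ (U m).1) →ₐ[R] R ⊗[k] Γ(X.left, (U j).1 ⊓ (U l).1 ⊓ (U m).1))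
    (_ : ∀ a s, Φjm (a ⊗ₜ s) = a ⊗ₜ X.left.presheaf.map
      (homOfLE (le_inf (inf_le_left.trans inf_le_left) inf_le_right)).op s)
    (ρjl ρlm ρjm : R ⊗[k] Γ(X.left, (U j).1 ⊓ (U l).1 ⊓ (U m).1) ≃ₐ[R]
      R ⊗[k] Γ(X.left, (U j).1 ⊓ (U l).1 ⊓ (U m).1)),
    (∀ x, ρjl (Φjl x) = Φjl (ψ j l x)) → (∀ x, ρlm (Φlm x) = Φlm (ψ l m x)) →
    (∀ x, ρjm (Φjm x) = Φjm (ψ j m x)) → ρlm * ρjl = ρjm)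

include halg hb h𝔫 hψ in
/-- The transition maps have the same underlying map as the chart projections: `chartProj l (t j l x) = chartProj j x`.
[cite: Hartshorne2010, Thm. 10.2 (proof), p. 81] -/
theorem chartProj_transitionMap_apply (j l : ι) (x : chartOverlap R U j l) :
    chartProj R U l (transitionMap halg R U ψ j l x) = chartProj R U j ((chartOverlap R U j l).ι x) :=
  chart_transition_apply (U j).2 (U l).2 (isAffineOpen_inf₂ U b hb j l) (chartProj R U j) rfl (chartProj R U l) rfl
    (chartOverlap_le R U j l) (overlapRingHom_one_tmul halg R U j l) (ψ j l)
    (fun x => SmoothAffineDeformation.isNilpotent_of_mem_smul_top 𝔫 h𝔫 (hψ j l x)) (baseChangeRight_tmul halg R U j l) x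

include hb h𝔫 hψ in
/-- **THE GLUE DATUM of cocycle-exact lifted gluing data** (★ `OpensGlueDatum`): charts `Spec (R ⊗_k Γ(U j))`, opens
`chartOverlap`, transitions `transitionMap`. [cite: StacksProject, Tag 01JA] [cite: Hartshorne2010, Thm. 10.2 (proof), p. 81] -/
def deformationGlueDatum : OpensGlueDatum.{u} where
  J := ι
  U j := Spec (CommRingCat.of (R ⊗[k] Γ(X.left, (U j).1)))
  W := chartOverlap R U
  t := transitionMap halg R U ψ
  W_self j := by
    rw [chartOverlap_eq, inf_idem]
    exact chart_preimage_self (U j).2 (chartProj R U j) rfl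
  t_self j := by
    rw [transitionMap_eq]
    exact transition_self (U j).2 (chartProj R U j) rfl (chartOverlap_le R U j j) (overlapRingHom_tmul_one halg R U j j)
      (overlapRingHom_one_tmul halg R U j j) (ψ j j)
      (apply_eq_self_of_cocycle_self halg 𝔫 h𝔫 (isAffineOpen_inf₂ U b hb j j)
        (X.left.presheaf.map (homOfLE (inf_le_left : (U j).1 ⊓ (U j).1 ≤ (U j).1)).op (b j j))
        (inf_eq_basicOpen_map U b hb inf_le_left j) (ψ j j) (hψ j j) (hcoc j j j))
      (baseChangeRight_tmul halg R U j j)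
  t_mem j l x := by
    change chartProj R U l (transitionMap halg R U ψ j l x) ∈ (U l).1 ⊓ (U j).1
    rw [chartProj_transitionMap_apply halg R U b hb ψ 𝔫 h𝔫 hψ, inf_comm]
    exact x.2
  dom j l m x hx := by
    change chartProj R U l (transitionMap halg R U ψ j l x) ∈ (U l).1 ⊓ (U m).1
    rw [chartProj_transitionMap_apply halg R U b hb ψ 𝔫 h𝔫 hψ]
    exact ⟨x.2.2, hx.2⟩
  cocycle i j l O a b' c ha hb' hc := by
    rw [transitionMap_eq] at hb'
    rw [transitionMap_eq, transitionMap_eq]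
    exact transition_cocycle halg (U i).2 (U j).2 (isAffineOpen_inf₂ U b hb i j) (chartProj R U i) rfl
      (chartProj R U j) rfl (isAffineOpen_inf₂ U b hb j l) (isAffineOpen_inf₂ U b hb i l) 𝔫 h𝔫
      (X.left.presheaf.map (homOfLE (inf_le_left : (U i).1 ⊓ (U j).1 ≤ (U i).1)).op (b i l))
      (inf_eq_basicOpen_map U b hb inf_le_left l)
      (X.left.presheaf.map (homOfLE (inf_le_left : (U j).1 ⊓ (U l).1 ≤ (U j).1)).op (b j i))
      (by rw [← inf_eq_basicOpen_map U b hb inf_le_left i]; ac_rfl)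
      (X.left.presheaf.map (homOfLE (inf_le_left : (U i).1 ⊓ (U l).1 ≤ (U i).1)).op (b i j))
      (by rw [← inf_eq_basicOpen_map U b hb inf_le_left j]; ac_rfl)
      (chartOverlap_le R U i j) (overlapRingHom_tmul_one halg R U i j) (overlapRingHom_one_tmul halg R U i j)
      (chartOverlap_le R U j l) (overlapRingHom_tmul_one halg R U j l) (overlapRingHom_one_tmul halg R U j l)
      (chartOverlap_le R U i l) (overlapRingHom_tmul_one halg R U i l) (overlapRingHom_one_tmul halg R U i l)
      (ψ i j) (hψ i j) (ψ j l) (hψ j l) (ψ i l) (hψ i l)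
      (baseChangeRight_tmul halg R U i j) (baseChangeRight_tmul halg R U j l) (baseChangeRight_tmul halg R U i l)
      (hcoc i j l) a ha b' hb' c hc

end Literature.AlgebraicGeometry.Deformation

end
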